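import Mathlib
import Summits.MatrixMultiplication.Statement
import Summits.MatrixMultiplication.MatrixMultiplication.Theorems.GraphEquationsJetBridge

/-!
# GraphEquations — KERNEL 2-JETS from polynomial kernel sections (M18e-1, decomp-mm-lens-5 g31)

(supports `MultiplicityReduction`, stmt-MatrixMultiplication-27806, hand 1 = BOP′ at `K = 2`.)

The classical input `KernelJetLift` (B2 of module `GraphEquationsJetBridge`) asks, for a
polynomial matrix `R(y)` at a point of maximal rank and `γ ∈ ker R(0)`, for an AFFINE field
`ξ = γ + λ·y` and polynomials `M_q` such that `Σ_q ξ_q R_oq + Σ_q R_oq(0) M_q` has no degree-`2`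
terms.  This module reduces it to the statement a linear algebraist would prove —
`KernelSectionAtMaxRank`: **there is a POLYNOMIAL kernel section `η` (`R η = 0` identically) with
`η(0) = c·γ`, `c ≠ 0`** (generalised Cramer rule on a maximal non-vanishing minor; module M18e-2
proves it) — by JET EXTRACTION: `ξ := c⁻¹·(η)_{≤1}`, `M := c⁻¹η − ξ`; then
`ξ·R_o + R_o(0)·M = −Σ_q M_q (R_oq − R_oq(0))` (using `η·R_o = 0`), a sum of products
(order `≥ 2`) × (order `≥ 1`), which has no degree-`2` part.

* `coeff_mul_eq_zero_of_orders` — `f` without terms of degree `≤ 1`, `g` without constant term ⇒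
  `f·g` has no degree-`2` terms.
* `kernelJetLift_of_kernelSection : KernelSectionAtMaxRank → KernelJetLift`.
* `boundedOrderPurification_two_of_kernelSection` — rung `K = 2` from
  `KernelSectionAtMaxRank ∧ IsolationAtMaxRank`.

No `sorry`.  Sources: [LeykinVerscheldeZhao2006, §3]; [CoxLittleOShea2015, Ch. 5 §3 (Cramer over
`k[y]`)].
-/

set_option linter.dupNamespace false

noncomputable section

open scoped BigOperators

namespace Summit.MatrixMultiplication.MatrixMultiplication.Theorems.GraphEquations

open MvPolynomial
open Literature.Computability.AlgebraicComplexity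

variable {n : ℕ}

/-! ## The classical statement: polynomial kernel sections at a max-rank point -/

/-- **POLYNOMIAL KERNEL SECTIONS AT A POINT OF MAXIMAL RANK.**  For a matrix `R` of polynomials:
if `rank R(y) ≤ rank R(0)` for all `y` and `R(0) γ = 0`, then there are polynomials `η_q` with
`Σ_q R_oq η_q = 0` for every row `o` (identically) and `η(0) = c·γ` for some `c ≠ 0`.
(Cramer: `c = Δ(0)` for a maximal minor `Δ` with `Δ(0) ≠ 0`; module M18e-2.) -/
def KernelSectionAtMaxRank : Prop :=
  ∀ (n T : ℕ) (R : Fin T → Fin n × Fin n → MvPolynomial (MatMulVars n) ℂ),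
    (∀ y : MatMulVars n → ℂ,
      (Matrix.of fun o q => eval y (R o q)).rank ≤ (Matrix.of fun o q => eval 0 (R o q)).rank) →
    ∀ γ : Fin n × Fin n → ℂ, (Matrix.of fun o q => eval 0 (R o q)).mulVec γ = 0 →
      ∃ (η : Fin n × Fin n → MvPolynomial (MatMulVars n) ℂ) (c : ℂ), c ≠ 0 ∧
        (∀ o, ∑ q, R o q * η q = 0) ∧ ∀ q, eval 0 (η q) = c * γ q

/-! ## Orders of vanishing -/

section orders

variable {σ : Type*}

/-- A monomial of degree `≤ 1` is `0` or a variable. -/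
theorem eq_zero_or_single_of_degree_le_one (m : σ →₀ ℕ) (hm : m.degree ≤ 1) :
    m = 0 ∨ ∃ v, m = Finsupp.single v 1 := by
  classical
  by_cases h0 : m = 0
  · exact Or.inl h0
  right
  obtain ⟨v, hv⟩ : ∃ v, v ∈ m.support := Finset.nonempty_iff_ne_empty.mpr (by
    rwa [Ne, Finsupp.support_eq_empty])
  have hmv : m v ≠ 0 := Finsupp.mem_support_iff.mp hv
  have hsplit := Finsupp.single_add_erase v m
  have hdeg := congrArg Finsupp.degree hsplit
  rw [map_add, Finsupp.degree_single] at hdeg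
  have hv1 : m v = 1 := by
    have : (m.erase v).degree + m v = m.degree := by rw [← hdeg]; ring
    omega
  have herase : m.erase v = 0 := by
    rw [← Finsupp.degree_eq_zero_iff]
    omega
  refine ⟨v, ?_⟩
  rw [← hsplit, hv1, herase, add_zero]

variable {R : Type*} [CommSemiring R]

/-- **Orders multiply**: if `f` has no terms of degree `≤ 1` and `g` has no constant term, then
`f·g` has no terms of degree `2`. -/
theorem coeff_mul_eq_zero_of_orders {f g : MvPolynomial σ R}
    (hf : ∀ m : σ →₀ ℕ, m.degree ≤ 1 → coeff m f = 0) (hg : coeff 0 g = 0)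
    {m : σ →₀ ℕ} (hm : m.degree = 2) : coeff m (f * g) = 0 := by
  classical
  rw [coeff_mul]
  refine Finset.sum_eq_zero fun x hx => ?_
  replace hx : x.1 + x.2 = m := Finset.HasAntidiagonal.mem_antidiagonal.mp hx
  by_cases h1 : x.1.degree ≤ 1
  · rw [hf x.1 h1, zero_mul]
  · have hdeg := congrArg Finsupp.degree hx
    rw [map_add, hm] at hdeg
    have h2 : x.2.degree = 0 := by omega
    rw [(Finsupp.degree_eq_zero_iff _).mp h2, hg, mul_zero]

end orders

/-! ## Coefficients of affine fields -/

/-- Constant term of an affine field. -/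
theorem coeff_zero_affField (γ : Fin n × Fin n → ℂ) (lam : Fin n × Fin n → MatMulVars n → ℂ)
    (q : Fin n × Fin n) : coeff 0 (affField γ lam q) = γ q := by
  classical
  simp only [affField, coeff_add, coeff_C, if_true, coeff_sum, coeff_smul, coeff_X, smul_eq_mul]
  rw [Finset.sum_eq_zero fun v _ => ?_, add_zero]
  rw [if_neg (Finsupp.single_ne_zero.mpr one_ne_zero), mul_zero]

/-- Linear coefficients of an affine field. -/
theorem coeff_single_affField (γ : Fin n × Fin n → ℂ) (lam : Fin n × Fin n → MatMulVars n → ℂ)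
    (q : Fin n × Fin n) (v : MatMulVars n) :
    coeff (Finsupp.single v 1) (affField γ lam q) = lam q v := by
  classical
  simp only [affField, coeff_add, coeff_C, coeff_sum, coeff_smul, coeff_X, smul_eq_mul]
  rw [if_neg (Finsupp.single_ne_zero.mpr one_ne_zero).symm, zero_add,
    Finset.sum_eq_single v (fun w _ hw => ?_) (fun h => absurd (Finset.mem_univ v) h)]
  · simp
  · rw [if_neg, mul_zero]
    intro h
    exact hw (Finsupp.single_left_injective one_ne_zero h)

/-! ## Jet extraction -/

/-- **JET EXTRACTION**: a polynomial kernel section through `c·γ` (`c ≠ 0`) yields an affine field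
`ξ` through `γ` and data `M` with `ξ·R_o + R_o(0)·M` free of degree-`2` terms, for every row. -/
theorem jet_of_kernelSection {T : ℕ} (R : Fin T → Fin n × Fin n → MvPolynomial (MatMulVars n) ℂ)
    (γ : Fin n × Fin n → ℂ) (η : Fin n × Fin n → MvPolynomial (MatMulVars n) ℂ) {c : ℂ}
    (hc : c ≠ 0) (hker : ∀ o, ∑ q, R o q * η q = 0) (h0 : ∀ q, eval 0 (η q) = c * γ q) :
    ∃ (lam : Fin n × Fin n → MatMulVars n → ℂ) (M : Fin n × Fin n → MvPolynomial (MatMulVars n) ℂ),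
      ∀ (o : Fin T) (m : MatMulVars n →₀ ℕ), m.degree = 2 →
        coeff m (∑ q, affField γ lam q * R o q + ∑ q, C (eval 0 (R o q)) * M q) = 0 := by
  classical
  set lam : Fin n × Fin n → MatMulVars n → ℂ := fun q v => c⁻¹ * coeff (Finsupp.single v 1) (η q)
    with hlam
  set M : Fin n × Fin n → MvPolynomial (MatMulVars n) ℂ := fun q => C c⁻¹ * η q - affField γ lam q
    with hM
  refine ⟨lam, M, fun o m hm => ?_⟩
  -- `ξ·R_o + R_o(0)·M = -Σ_q M_q (R_oq - R_oq(0))`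
  have hsum : (∑ q, affField γ lam q * R o q + ∑ q, C (eval 0 (R o q)) * M q) =
      -∑ q, M q * (R o q - C (eval 0 (R o q))) := by
    rw [← sub_eq_zero, sub_neg_eq_add, ← Finset.sum_add_distrib, ← Finset.sum_add_distrib,
      show (∑ q, (affField γ lam q * R o q + C (eval 0 (R o q)) * M q +
          M q * (R o q - C (eval 0 (R o q))))) = ∑ q, C c⁻¹ * (R o q * η q) from
        Finset.sum_congr rfl fun q _ => by simp only [hM]; ring,
      ← Finset.mul_sum, hker o, mul_zero]
  rw [hsum, coeff_neg, neg_eq_zero, coeff_sum]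
  refine Finset.sum_eq_zero fun q _ => coeff_mul_eq_zero_of_orders (fun m' hm' => ?_) ?_ hm
  · -- `M_q` has no terms of degree `≤ 1`
    have hη0 : coeff 0 (η q) = c * γ q := by
      rw [← h0 q, MvPolynomial.eval_zero, constantCoeff_eq]
    rcases eq_zero_or_single_of_degree_le_one m' hm' with rfl | ⟨v, rfl⟩
    · simp only [hM, coeff_sub, coeff_C_mul, hη0, coeff_zero_affField]
      field_simp
      ring
    · simp only [hM, coeff_sub, coeff_C_mul, coeff_single_affField, hlam, sub_self]
  · -- `R_oq - R_oq(0)` has no constant term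
    rw [coeff_sub, coeff_C, if_pos rfl, MvPolynomial.eval_zero, constantCoeff_eq, sub_self]

/-- **B2 from kernel sections**: `KernelSectionAtMaxRank → KernelJetLift`. -/
theorem kernelJetLift_of_kernelSection (h : KernelSectionAtMaxRank) : KernelJetLift := by
  intro n T R hrank γ hγ
  obtain ⟨η, c, hc, hker, h0⟩ := h n T R hrank γ hγ
  exact jet_of_kernelSection R γ η hc hker h0

/-- Rung `K = 2` of bounded-order purification from `KernelSectionAtMaxRank ∧ IsolationAtMaxRank`. -/
theorem boundedOrderPurification_two_of_kernelSection (hK : KernelSectionAtMaxRank)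
    (hI : IsolationAtMaxRank) :
    ∀ β : ℝ, 2 ≤ β → EqAdmissibleIdealIso β 2 → ∀ β' : ℝ, β < β' → EqAdmissiblePure β' :=
  boundedOrderPurification_two_of_bridges (kernelJetLift_of_kernelSection hK) hI

end Summit.MatrixMultiplication.MatrixMultiplication.Theorems.GraphEquations

end
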